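import Mathlib
import HarnessLib
import Literature.NumberTheory.LFunctions.HorocyclePhase
import Literature.Analysis.FunctionSpaces.SmoothParametricIntegral

/-!
# The zero Fourier mode of the horocycle integral of a strip test

Support file (all statements PROVED, no definitions, no named facts) for the elementary proof of
the unconditional rate `m_F(y) = c + O(y^{1/2})` of equidistribution of closed horocycles on
`SL(2,ℤ)\ℍ` (`Literature.NumberTheory.LFunctions.zagier_sarnak_horocycle_rate_half`; Sarnak 1981,
Thm. 1), continuing `HorocycleStripFourier.lean` and `HorocyclePhase.lean`.

For a strip test `f` with horizontal averages `m(h) = ∫₀¹ f(x+ih) dx` and horocycle integral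
`Ψ(w,θ) = ∫_ℝ f(θ - 1/(w(t+i))) dt`, the zero Fourier mode `∫₀¹ Ψ(w,θ) dθ = ∫_ℝ m(1/(w(1+t²))) dt`
is governed by the *zero-mode kernel* `K(l) = ∫_{-S}^{S} m(1/(l²+s²)) ds` (`S = 1 + 1/a`):

* `m` is smooth and vanishes off `(a, b)` (`contDiff_horizontalAverage`,
  `horizontalAverage_eq_zero`);
* `K` is smooth on `ℝ` (`contDiff_zeroKernel`; the kernel `(s,l) ↦ m(1/(l²+s²))` vanishes near the
  disc `l²+s² ≤ 1/b` and is a composition of smooth maps elsewhere, `contDiff_kernel₂`) and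
  vanishes on `[1 + 1/a, ∞)` (`zeroKernel_eq_zero`);
* `l ∫₀¹ Ψ(l², θ) dθ = K(l)` for `l > 0` (`mul_coeffPsi_zero_eq`, the substitution `s = lt`).
This is the interface `k : ℝ → ℂ`, `ContDiff ℝ 2 k`, `k = 0` on `[R, ∞)` of the landed zero-mode
lemma `Literature.NumberTheory.LFunctions.HorocycleZeroMode.zeroMode_bound`.

## References
* P. Sarnak, *Asymptotic behavior of periodic orbits of the horocycle flow and Eisenstein
  series*, Comm. Pure Appl. Math. 34 (1981), 719–739, Thm. 1 [Sarnak1981].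
* H. Iwaniec, *Spectral Methods of Automorphic Forms*, 2nd ed., AMS GSM 53 (2002), §3.4
  [Iwaniec2002].
-/

noncomputable section

open Complex MeasureTheory Set Filter Topology intervalIntegral
open scoped Real ContDiff

namespace Literature.NumberTheory.LFunctions

namespace HorocycleZeroKernel

open HorocycleStripFourier HorocyclePhase

variable {f : ℂ → ℂ} {a b : ℝ}

/-! ### The horizontal average `m(h) = ∫₀¹ f(x + ih) dx` -/

/-- `m` is smooth (differentiation under the integral sign, tree lemma
`contDiff_parametric_intervalIntegral`). [folklore] -/
theorem contDiff_horizontalAverage (hf : ContDiff ℝ ∞ f) :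
    ContDiff ℝ ∞ fun h : ℝ => ∫ x in (0:ℝ)..1, f (x + h * I) := by
  have hA : ContDiff ℝ ∞ fun p : ℝ × ℝ => (p.1 : ℂ) + (p.2 : ℂ) * I :=
    (Complex.ofRealCLM.contDiff.comp contDiff_fst).add
      ((Complex.ofRealCLM.contDiff.comp contDiff_snd).mul contDiff_const)
  exact Literature.Analysis.FunctionSpaces.contDiff_parametric_intervalIntegral
    (H := fun p : ℝ × ℝ => f ((p.1 : ℂ) + (p.2 : ℂ) * I)) (hf.comp hA) 0 1

/-- `m(h) = 0` unless `a < h < b`. [folklore] -/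
theorem horizontalAverage_eq_zero (hfc : Continuous f)
    (hsupp : ∀ z, f z ≠ 0 → a ≤ z.im ∧ z.im ≤ b) {h : ℝ} (hh : ¬(a < h ∧ h < b)) :
    ∫ x in (0:ℝ)..1, f (x + h * I) = 0 := by
  have h0 : ∀ x : ℝ, f (x + h * I) = 0 := fun x => by
    by_contra hx
    have := im_mem_Ioo_of_ne_zero hfc hsupp hx
    simp only [add_im, ofReal_im, mul_im, ofReal_re, I_im, mul_one, I_re, mul_zero, add_zero,
      zero_add] at this
    exact hh this
  simp [h0]

/-- The `0`-th coefficient along a horizontal line is the horizontal average. [folklore] -/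
theorem coeff_zero_eq (f : ℂ → ℂ) (h : ℝ) :
    ∫ x in (0:ℝ)..1, f (x + h * I) * Complex.exp (-(2 * π * I * ((0:ℤ) : ℂ) * x)) =
      ∫ x in (0:ℝ)..1, f (x + h * I) := by
  simp

/-! ### The zero-mode kernel `K(l) = ∫ m(1/(l²+s²)) ds` -/

/-- The two-variable kernel `(s, l) ↦ m(1/(l²+s²))` is smooth on `ℝ²`: it vanishes near the
disc `l² + s² ≤ 1/b` (where the height exceeds `b`, or is the junk value `1/0 = 0 < a`), and
away from the origin it is a composition of smooth maps. [folklore] -/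
theorem contDiff_kernel₂ (hf : ContDiff ℝ ∞ f) (hsupp : ∀ z, f z ≠ 0 → a ≤ z.im ∧ z.im ≤ b)
    (ha : 0 < a) (hab : a ≤ b) :
    ContDiff ℝ ∞ fun p : ℝ × ℝ => ∫ x in (0:ℝ)..1, f (x + (1 / (p.2 ^ 2 + p.1 ^ 2) : ℝ) * I) := by
  have hb : 0 < b := lt_of_lt_of_le ha hab
  set m : ℝ → ℂ := fun h => ∫ x in (0:ℝ)..1, f (x + h * I) with hm
  have hmC : ContDiff ℝ ∞ m := contDiff_horizontalAverage hf
  have hm0 : ∀ h, ¬(a < h ∧ h < b) → m h = 0 := fun h hh =>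
    horizontalAverage_eq_zero hf.continuous hsupp hh
  change ContDiff ℝ ∞ fun p : ℝ × ℝ => m (1 / (p.2 ^ 2 + p.1 ^ 2))
  refine contDiff_iff_contDiffAt.2 fun p => ?_
  by_cases hp : p.2 ^ 2 + p.1 ^ 2 < 1 / b
  · -- vanishes identically near `p`
    have hU : {q : ℝ × ℝ | q.2 ^ 2 + q.1 ^ 2 < 1 / b} ∈ 𝓝 p :=
      (isOpen_lt (by fun_prop) continuous_const).mem_nhds hp
    refine (contDiffAt_const (c := (0:ℂ))).congr_of_eventuallyEq ?_
    filter_upwards [hU] with q hq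
    apply hm0
    rintro ⟨h1, h2⟩
    rcases (add_nonneg (sq_nonneg q.2) (sq_nonneg q.1)).eq_or_lt with h0 | h0
    · rw [← h0, div_zero] at h1; exact absurd h1 (not_lt.mpr ha.le)
    · -- `1/(l²+s²) > b`
      have : b < 1 / (q.2 ^ 2 + q.1 ^ 2) := by
        rw [lt_div_iff₀ h0]; rw [lt_div_iff₀ hb] at hq; linarith [mul_comm b (q.2 ^ 2 + q.1 ^ 2)]
      linarith
  · -- smooth near `p`
    have hne : p.2 ^ 2 + p.1 ^ 2 ≠ 0 := by
      intro h0; rw [h0] at hp; exact hp (by positivity)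
    have hq : ContDiffAt ℝ ∞ (fun q : ℝ × ℝ => 1 / (q.2 ^ 2 + q.1 ^ 2)) p :=
      contDiffAt_const.div (by fun_prop) hne
    exact hmC.contDiffAt.comp p hq

/-- **Smoothness of the zero-mode kernel** `K(l) = ∫_{-S}^{S} m(1/(l²+s²)) ds`. [folklore] -/
theorem contDiff_zeroKernel (hf : ContDiff ℝ ∞ f) (hsupp : ∀ z, f z ≠ 0 → a ≤ z.im ∧ z.im ≤ b)
    (ha : 0 < a) (hab : a ≤ b) (S : ℝ) :
    ContDiff ℝ ∞ fun l : ℝ => ∫ s in (-S)..S,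
      ∫ x in (0:ℝ)..1, f (x + (1 / (l ^ 2 + s ^ 2) : ℝ) * I) :=
  Literature.Analysis.FunctionSpaces.contDiff_parametric_intervalIntegral
    (H := fun p : ℝ × ℝ => ∫ x in (0:ℝ)..1, f (x + (1 / (p.2 ^ 2 + p.1 ^ 2) : ℝ) * I))
    (contDiff_kernel₂ hf hsupp ha hab) (-S) S

/-- The zero-mode kernel vanishes for `l ≥ 1 + 1/a` (all heights `1/(l²+s²)` are `< a`).
[folklore] -/
theorem zeroKernel_eq_zero (hfc : Continuous f) (hsupp : ∀ z, f z ≠ 0 → a ≤ z.im ∧ z.im ≤ b)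
    (ha : 0 < a) (S : ℝ) {l : ℝ} (hl : 1 + 1 / a ≤ l) :
    ∫ s in (-S)..S, ∫ x in (0:ℝ)..1, f (x + (1 / (l ^ 2 + s ^ 2) : ℝ) * I) = 0 := by
  have ha' : 0 < 1 / a := one_div_pos.mpr ha
  have hl1 : 1 ≤ l := by linarith
  have h0 : ∀ s : ℝ, ∫ x in (0:ℝ)..1, f (x + (1 / (l ^ 2 + s ^ 2) : ℝ) * I) = 0 := by
    intro s
    apply horizontalAverage_eq_zero hfc hsupp
    rintro ⟨h1, -⟩
    have hls : 1 / a < l ^ 2 + s ^ 2 := by nlinarith [sq_nonneg s]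
    have hpos : 0 < l ^ 2 + s ^ 2 := by nlinarith [sq_nonneg s]
    rw [lt_div_iff₀ hpos] at h1
    rw [div_lt_iff₀ ha] at hls
    nlinarith
  simp only [h0, intervalIntegral.integral_zero]

/-- Support of the zero-mode integrand in `s`: `m(1/(l²+s²)) ≠ 0` forces `|s| < 1 + 1/a`.
[folklore] -/
theorem abs_lt_of_kernel_ne_zero (hfc : Continuous f)
    (hsupp : ∀ z, f z ≠ 0 → a ≤ z.im ∧ z.im ≤ b) (ha : 0 < a) {l s : ℝ}
    (h : (∫ x in (0:ℝ)..1, f (x + (1 / (l ^ 2 + s ^ 2) : ℝ) * I)) ≠ 0) : |s| < 1 + 1 / a := by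
  have ha' : 0 < 1 / a := one_div_pos.mpr ha
  by_contra hs
  rw [not_lt] at hs
  apply h
  apply horizontalAverage_eq_zero hfc hsupp
  rintro ⟨h1, -⟩
  have hs1 : 1 ≤ |s| := by linarith
  have hls : 1 / a < l ^ 2 + s ^ 2 := by nlinarith [sq_nonneg l, sq_abs s]
  have hpos : 0 < l ^ 2 + s ^ 2 := by nlinarith [sq_nonneg l, sq_abs s]
  rw [lt_div_iff₀ hpos] at h1
  rw [div_lt_iff₀ ha] at hls
  nlinarith

/-- **The zero mode.** For `l > 0`,
`l ∫₀¹ Ψ(l², θ) dθ = ∫_{-S}^{S} m(1/(l²+s²)) ds` with `S = 1 + 1/a`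
(the `k = 0` case of `coeff_integral_apply_hpt`, then `s = lt`). [folklore] -/
theorem mul_coeffPsi_zero_eq (hfc : Continuous f) (hper : ∀ z, f (z + 1) = f z)
    (hsupp : ∀ z, f z ≠ 0 → a ≤ z.im ∧ z.im ≤ b) (ha : 0 < a) {l : ℝ} (hl : 0 < l) :
    (l : ℂ) * ∫ θ in (0:ℝ)..1, (∫ t : ℝ, f ((θ : ℂ) - 1 / (((l ^ 2 : ℝ) : ℂ) * ((t : ℂ) + I)))) *
        Complex.exp (-(2 * π * I * ((0:ℤ) : ℂ) * θ)) =
      ∫ s in (-(1 + 1 / a))..(1 + 1 / a),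
        ∫ x in (0:ℝ)..1, f (x + (1 / (l ^ 2 + s ^ 2) : ℝ) * I) := by
  rw [coeff_integral_apply_hpt hfc hper hsupp ha (pow_pos hl 2) 0]
  simp only [Int.cast_zero, mul_zero, zero_mul, neg_zero, Complex.exp_zero, one_mul, mul_one]
  set φ : ℝ → ℂ := fun s => ∫ x in (0:ℝ)..1, f (x + (1 / (l ^ 2 + s ^ 2) : ℝ) * I) with hφ
  have hsub : ∫ t : ℝ, (∫ x in (0:ℝ)..1, f (x + (1 / (l ^ 2 * (1 + t ^ 2)) : ℝ) * I)) =
      |l⁻¹| • ∫ s, φ s := by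
    rw [← Measure.integral_comp_mul_left φ l]
    congr 1; ext t
    simp only [hφ]
    congr 1; ext x
    congr 2
    push_cast
    ring
  rw [hsub, abs_of_pos (inv_pos.mpr hl), Complex.real_smul, ← mul_assoc, ← ofReal_mul,
    mul_inv_cancel₀ hl.ne', ofReal_one, one_mul]
  symm
  apply intervalIntegral.integral_eq_integral_of_support_subset
  intro s hs
  rw [Function.mem_support] at hs
  have := abs_lt_of_kernel_ne_zero hfc hsupp ha hs
  rw [abs_lt] at this
  exact ⟨this.1, this.2.le⟩

end HorocycleZeroKernel

end Literature.NumberTheory.LFunctions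

end
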